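import Literature.Topology.FourManifolds.RegularDomainExtension
import Literature.Topology.FourManifolds.RegularLevelSplitting
import Mathlib.Geometry.Manifold.PartitionOfUnity
import HarnessLib

/-!
# Functions on a regular sublevel set of a manifold without boundary versus functions on the
# ambient manifold: extension (Seeley) and transfer of critical points and Hessians

Topic `Literature/Topology/FourManifolds`; infrastructure for Phillips' Lemma 1.1 (consumer: the
named fact
`Literature.Topology.Immersions.Phillips1967_exists_isLocalDiffeomorph_of_isParallelizable`),
where Morse functions produced on the triads `Mᵢ₊₁' - Int Mᵢ'` of an open manifold (compact
manifolds with boundary, the tree's `Literature.Topology.FourManifolds.RegularSublevel`) have to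
be *"fitted together to give a non-negative, proper Morse function `f` on `M`"* (Phillips 1967,
proof of Lemma 1.1, p. 176): they are first extended to, and then read on, the ambient manifold
without boundary. Everything here is **proved**; no definitions, no named facts.

* §1 **Seeley extension for a regular domain of a manifold over any model on `ℝᵏ⁺¹`** — the
  tree's `HalfSliceAtlas.exists_contMDiff_forall_eq` (`RegularDomainExtension.lean`, ambient
  manifold *with* boundary) verbatim for an arbitrary model with corners `I` on `ℝᵏ⁺¹`, in
  particular for manifolds without boundary (`𝓡 (k + 1)`):
  `HalfSliceAtlas.exists_contMDiff_forall_eq'`; the case of a regular sublevel set `{f ≤ a}` of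
  a manifold without boundary is `RegularSublevel.exists_contMDiff_forall_eq_comp_incl` (Lee
  2013, Lemma 2.26 with Thm. 5.48; Seeley 1964).
* §2 **Transfer at every point: criticality** — for a smooth `F` on the ambient manifold
  without boundary, `p` is a critical point of `F ∘ incl` on `{f ≤ a}` iff `incl p` is a
  critical point of `F` (`RegularSublevel.isMCriticalPt_comp_incl_iff`; both are read off
  `d(F ∘ Θₚ⁻¹)(Θₚ p)` in the half-slice chart `Θₚ`, whose inverse has onto differential).
* §3 **Transfer off the level: Hessians and indices** — at a point with `f p < a` the
  half-slice chart is the translated extended chart of `M`, so the Hessians of `F ∘ incl` and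
  of `F` agree (`RegularSublevel.mhessian_comp_incl_eq`, second derivatives being translation
  invariant; no smoothness needed), hence so do nondegeneracy and the Morse index
  (`RegularSublevel.morseIndex_comp_incl_eq`); and `F ∘ incl` is smooth near `p` iff `F` is
  (`RegularSublevel.contMDiffAt_comp_incl_iff`). This is the pattern of the tree's
  `sublevel'_morseData` (the case `F = f`) and `RegularSlabTransfer.lean` (ambient manifold with
  boundary). Milnor, *Morse theory* (1963), Thm. 3.1 and §3: the critical points of `f|Mᵃ`
  below `a` are those of `f`.

## References

* A. Phillips, *Submersions of open manifolds*, Topology **6** (1967), proof of Lemma 1.1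
  (p. 176). [Phillips1967]
* J. M. Lee, *Introduction to Smooth Manifolds*, 2nd ed. (2013), Lemma 2.26, Thm. 5.48.
  [LeeSmoothManifolds2013]
* R. T. Seeley, *Extension of `C^∞` functions defined in a half space*, Proc. AMS 15 (1964),
  625–626. [Seeley1964]
* J. Milnor, *Morse theory* (1963), Thm. 3.1 and §3. [Milnor1963]
-/

open scoped Manifold ContDiff Topology
open Set Function Filter

noncomputable section

universe u

namespace Literature.Topology.FourManifolds

/-! ### §1 Seeley extension over an arbitrary model on `ℝᵏ⁺¹` -/

namespace HalfSliceAtlas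

section AnyModel

variable {k : ℕ} {H : Type*} [TopologicalSpace H] {I : ModelWithCorners ℝ (EuclideanSpace ℝ (Fin (k + 1))) H}
  {M : Type u} [TopologicalSpace M] [ChartedSpace H M] {S : Set M} (Φ : HalfSliceAtlas I S)
  {F : Type*} [NormedAddCommGroup F] [NormedSpace ℝ F]

/-- **Local extension across the boundary of a regular domain (Seeley)**, any model on
`ℝᵏ⁺¹`: a `C^∞` function `g : S → F` (complete `F`) agrees near any point of `S` with a
function `C^∞` on an open set of the ambient manifold. [cite: Seeley1964, Theorem] -/
theorem exists_contMDiffOn_eq_nhds' [CompleteSpace F] {g : S → F}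
    (hg : letI := Φ.chartedSpace; ContMDiff (𝓡∂ (k + 1)) 𝓘(ℝ, F) ∞ g) (p : S) :
    ∃ U : Set M, IsOpen U ∧ p.1 ∈ U ∧ ∃ G : M → F, ContMDiffOn I 𝓘(ℝ, F) ∞ G U ∧
      ∀ (y : M) (hy : y ∈ S), y ∈ U → G y = g ⟨y, hy⟩ := by
  letI := Φ.chartedSpace
  haveI := Φ.isManifold
  set D := Φ.datum p with hD
  have hpsrc : p.1 ∈ D.Θ.source := Φ.mem_source p
  -- `g` read in the preferred extended chart of `S` at `p` is `C^∞` within the half space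
  -- (the argument of `HalfSliceAtlas.contDiffOn_comp_extend_symm`, valid over any model)
  have hread : ContDiffOn ℝ ∞ (g ∘ (extChartAt (𝓡∂ (k + 1)) p).symm)
      (D.Θ.target ∩ {z | 0 ≤ z 0}) := by
    have hs : (extChartAt (𝓡∂ (k + 1)) p).source ⊆ (extChartAt (𝓡∂ (k + 1)) p).source :=
      Subset.rfl
    have h2s : MapsTo g (extChartAt (𝓡∂ (k + 1)) p).source (extChartAt 𝓘(ℝ, F) (g p)).source := by
      intro q _; simp
    have h := (contMDiffOn_iff_of_subset_source' hs h2s).1 hg.contMDiffOn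
    rw [extChartAt_model_space_eq_id, PartialEquiv.image_source_eq_target] at h
    have htgt : (extChartAt (𝓡∂ (k + 1)) p).target = D.Θ.target ∩ {z | 0 ≤ z 0} := by
      ext z
      rw [show extChartAt (𝓡∂ (k + 1)) p = (D.chart p).extend (𝓡∂ (k + 1)) from rfl,
        D.mem_extend_chart_target, mem_inter_iff, mem_setOf_eq, and_comm]
    rw [htgt] at h
    exact h
  obtain ⟨V, hVo, hpV, hVU, Gc, hGc, hGceq⟩ := exists_contDiffOn_extension_halfSpace D.Θ.open_target
    (D.Θ.map_source hpsrc) hread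
  refine ⟨D.Θ.source ∩ D.Θ ⁻¹' V, D.Θ.continuousOn.isOpen_inter_preimage D.Θ.open_source hVo,
    ⟨hpsrc, hpV⟩, Gc ∘ D.Θ, ?_, ?_⟩
  · have hGc' : ContMDiffOn 𝓘(ℝ, EuclideanSpace ℝ (Fin (k + 1))) 𝓘(ℝ, F) ∞ Gc V := contMDiffOn_iff_contDiffOn.2 hGc
    exact hGc'.comp (D.contMDiffOn_toFun.mono inter_subset_left) fun y hy => hy.2
  · intro y hyS hy
    have hy0 : 0 ≤ D.Θ y 0 := D.apply_zero_nonneg hy.1 hyS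
    have hyt : D.Θ y ∈ D.Θ.target := D.Θ.map_source hy.1
    rw [comp_apply, hGceq ⟨hy.2, hy0⟩, comp_apply]
    congr 1
    ext1
    rw [show extChartAt (𝓡∂ (k + 1)) p = (D.chart p).extend (𝓡∂ (k + 1)) from rfl,
      D.coe_extend_chart_symm_of_mem hy0 hyt, D.Θ.left_inv hy.1]

/-- **Smooth functions on a closed regular domain extend to the ambient manifold** (any model
on `ℝᵏ⁺¹`, e.g. an ambient manifold without boundary): for `S` closed in a σ-compact Hausdorff
`C^∞` manifold `M` with a half-slice atlas, every `C^∞` function `g : S → F` (complete `F`) is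
the restriction of a `C^∞` function on `M` (local Seeley extensions and `0` off `S`, glued by a
smooth partition of unity). [cite: LeeSmoothManifolds2013, Lemma 2.26] [cite: Seeley1964, Theorem] -/
theorem exists_contMDiff_forall_eq' [IsManifold I ∞ M] [T2Space M] [SigmaCompactSpace M]
    [CompleteSpace F] (hS : IsClosed S) {g : S → F}
    (hg : letI := Φ.chartedSpace; ContMDiff (𝓡∂ (k + 1)) 𝓘(ℝ, F) ∞ g) :
    ∃ G : M → F, ContMDiff I 𝓘(ℝ, F) ∞ G ∧ ∀ y : S, G y = g y := by
  classical
  let t : M → Set F := fun y => if h : y ∈ S then {g ⟨y, h⟩} else univ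
  have ht : ∀ y, Convex ℝ (t y) := by
    intro y
    by_cases h : y ∈ S
    · simp only [t, h, ↓reduceDIte]; exact convex_singleton _
    · simp only [t, h, ↓reduceDIte]; exact convex_univ
  have Hloc : ∀ x : M, ∃ U ∈ 𝓝 x, ∃ G : M → F,
      ContMDiffOn I 𝓘(ℝ, F) ∞ G U ∧ ∀ y ∈ U, G y ∈ t y := by
    intro x
    by_cases hx : x ∈ S
    · obtain ⟨U, hUo, hxU, G, hG, hGeq⟩ := Φ.exists_contMDiffOn_eq_nhds' hg ⟨x, hx⟩
      refine ⟨U, hUo.mem_nhds hxU, G, hG, fun y hy => ?_⟩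
      by_cases hyS : y ∈ S
      · simp only [t, hyS, ↓reduceDIte, mem_singleton_iff]
        exact hGeq y hyS hy
      · simp only [t, hyS, ↓reduceDIte, mem_univ]
    · refine ⟨Sᶜ, hS.isOpen_compl.mem_nhds hx, fun _ => 0, contMDiffOn_const, fun y hy => ?_⟩
      have hyS : y ∉ S := hy
      simp only [t, hyS, ↓reduceDIte, mem_univ]
  obtain ⟨G, hG⟩ := exists_contMDiffMap_forall_mem_convex_of_local I ht Hloc
  refine ⟨G, G.contMDiff, fun y => ?_⟩
  have := hG y
  simp only [t, y.2, ↓reduceDIte, mem_singleton_iff, Subtype.coe_eta] at this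
  exact this

end AnyModel

end HalfSliceAtlas

/-! ### Regular sublevel sets of a manifold without boundary -/

namespace RegularSublevel

variable {k : ℕ} {M : Type u} [TopologicalSpace M] [ChartedSpace (EuclideanSpace ℝ (Fin (k + 1))) M]
  [IsManifold (𝓡 (k + 1)) ∞ M] {f : M → ℝ} {a : ℝ} (h : IsRegularLevel (𝓡 (k + 1)) f a)

/-- **Smooth functions on a regular sublevel set `{f ≤ a}` of a manifold without boundary
extend to the ambient manifold** (`M` Hausdorff and σ-compact; complete target).
[cite: LeeSmoothManifolds2013, Lemma 2.26] [cite: Seeley1964, Theorem] -/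
theorem exists_contMDiff_forall_eq_comp_incl [T2Space M] [SigmaCompactSpace M]
    {F : Type*} [NormedAddCommGroup F] [NormedSpace ℝ F] [CompleteSpace F]
    {g : RegularSublevel h → F} (hg : ContMDiff (𝓡∂ (k + 1)) 𝓘(ℝ, F) ∞ g) :
    ∃ G : M → F, ContMDiff (𝓡 (k + 1)) 𝓘(ℝ, F) ∞ G ∧ ∀ p : RegularSublevel h, G (incl h p) = g p :=
  (halfSliceAtlas h).exists_contMDiff_forall_eq' (isClosed_preimage h) hg

/-! ### §2 Criticality transfers at every point -/

/-- **Critical points of the restriction of an ambient function are those of the function**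
(every point of `{f ≤ a}`, the level included): for a smooth `F` on `M`, `p` is critical for
`F ∘ incl` iff `incl p` is critical for `F`. [cite: Milnor1963, Thm. 3.1] -/
theorem isMCriticalPt_comp_incl_iff {F : M → ℝ} (hF : ContMDiff (𝓡 (k + 1)) 𝓘(ℝ, ℝ) ∞ F)
    (p : RegularSublevel h) :
    IsMCriticalPt (𝓡∂ (k + 1)) (F ∘ incl h) p ↔ IsMCriticalPt (𝓡 (k + 1)) F (incl h p) := by
  set Φ := halfSliceAtlas h with hΦ
  have hfn : ContMDiff (𝓡∂ (k + 1)) 𝓘(ℝ, ℝ) ∞ (F ∘ incl h) := hF.comp (contMDiff_incl h)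
  have hFΘ : ContDiffOn ℝ ∞ (F ∘ (Φ.datum p).Θ.symm) (Φ.datum p).Θ.target :=
    contMDiffOn_iff_contDiffOn.1 (hF.comp_contMDiffOn (Φ.datum p).contMDiffOn_symm)
  have hz₀ : (Φ.datum p).Θ p.1 ∈ (Φ.datum p).Θ.target :=
    (Φ.datum p).Θ.map_source (Φ.mem_source p)
  have hFΘd : DifferentiableAt ℝ (F ∘ (Φ.datum p).Θ.symm) ((Φ.datum p).Θ p.1) :=
    ((hFΘ _ hz₀).contDiffAt ((Φ.datum p).Θ.open_target.mem_nhds hz₀)).differentiableAt (by simp)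
  have key : mfderiv (𝓡∂ (k + 1)) 𝓘(ℝ, ℝ) (F ∘ incl h) p =
      fderiv ℝ (F ∘ (Φ.datum p).Θ.symm) ((Φ.datum p).Θ p.1) :=
    Φ.mfderiv_comp_val_eq F p (hfn.mdifferentiableAt (by simp)) hFΘd
  have e1 : IsMCriticalPt (𝓡∂ (k + 1)) (F ∘ incl h) p ↔
      fderiv ℝ (F ∘ (Φ.datum p).Θ.symm) ((Φ.datum p).Θ p.1) = 0 := by
    rw [IsMCriticalPt, key]
    exact Iff.rfl
  have e2 := isMCriticalPt_iff_fderiv_comp_symm_eq_zero (Φ.datum p).contMDiffOn_toFun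
      (Φ.datum p).contMDiffOn_symm (Φ.mem_source p) (hF.mdifferentiableAt (by simp))
  exact e1.trans e2.symm

/-! ### §3 Off the level: smoothness, Hessians, indices -/

/-- At a point with `f p < a` the half-slice chart of `{f ≤ a}` is the translated extended
chart of `M` at `incl p` (`sublevelChartLT'`). [folklore] -/
theorem halfSliceAtlas_datum_of_lt (p : RegularSublevel h) (hp : f (incl h p) < a) :
    (halfSliceAtlas h).datum p = sublevelChartLT' k f a h.contMDiff.continuous p.1 :=
  sublevelAtlas'_datum_of_lt h.contMDiff a _ p hp

/-- **Smoothness off the level transfers to the ambient manifold**: at a point with `f p < a`,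
an ambient function `F` is smooth at `incl p` as soon as `F ∘ incl` is smooth at `p` (there the
chart of `{f ≤ a}` is a chart of `M` and the model half space is a neighbourhood).
[cite: Milnor1963, Thm. 3.1] -/
theorem contMDiffAt_of_comp_incl {F : M → ℝ} (p : RegularSublevel h) (hp : f (incl h p) < a)
    (hF : ContMDiffAt (𝓡∂ (k + 1)) 𝓘(ℝ, ℝ) ∞ (F ∘ incl h) p) :
    ContMDiffAt (𝓡 (k + 1)) 𝓘(ℝ, ℝ) ∞ F (incl h p) := by
  set Φ := halfSliceAtlas h with hΦ
  set D := Φ.datum p with hDd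
  have hD : D = sublevelChartLT' k f a h.contMDiff.continuous p.1 := halfSliceAtlas_datum_of_lt h p hp
  have hps : p.1 ∈ D.Θ.source := Φ.mem_source p
  have h0 : 0 < D.Θ p.1 0 := by
    rw [hD] at hps ⊢
    exact sublevelChartLT'_apply_zero_pos hps
  -- `F ∘ incl` read in the preferred extended chart at `p` is smooth within the half-space
  have h1 := (contMDiffAt_iff.1 hF).2
  have hx : extChartAt (𝓡∂ (k + 1)) p p = D.Θ p.1 := Φ.extChartAt_self_apply p
  rw [hx] at h1
  simp only [extChartAt_model_space_eq_id, PartialEquiv.refl_coe, CompTriple.comp_eq] at h1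
  have hnhds : range (𝓡∂ (k + 1)) ∈ 𝓝 (D.Θ p.1) :=
    mem_interior_iff_mem_nhds.1 (by
      rw [interior_range_modelWithCornersEuclideanHalfSpace]; exact h0)
  have h2 : ContDiffAt ℝ ∞ ((F ∘ incl h) ∘ (extChartAt (𝓡∂ (k + 1)) p).symm) (D.Θ p.1) :=
    h1.contDiffAt hnhds
  have hz₀ : D.Θ p.1 ∈ D.Θ.target := D.Θ.map_source hps
  have heq : ((F ∘ incl h) ∘ (extChartAt (𝓡∂ (k + 1)) p).symm) =ᶠ[𝓝 (D.Θ p.1)] (F ∘ D.Θ.symm) := by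
    have hev0 : ∀ᶠ z in 𝓝 (D.Θ p.1), 0 ≤ z 0 := by
      filter_upwards [hnhds] with z hz
      rw [range_modelWithCornersEuclideanHalfSpace] at hz
      exact hz
    have hevt : ∀ᶠ z in 𝓝 (D.Θ p.1), z ∈ D.Θ.target := D.Θ.open_target.mem_nhds hz₀
    filter_upwards [hev0, hevt] with z hz0 hzt
    simp only [comp_apply]
    congr 1
    show ((((Φ.datum p).chart p).extend (𝓡∂ (k + 1))).symm z).1 = D.Θ.symm z
    exact (Φ.datum p).coe_extend_chart_symm_of_mem hz0 hzt
  have h3 : ContDiffAt ℝ ∞ (F ∘ D.Θ.symm) (D.Θ p.1) := h2.congr_of_eventuallyEq heq.symm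
  have hΘ : ContMDiffAt (𝓡 (k + 1)) 𝓘(ℝ, EuclideanSpace ℝ (Fin (k + 1))) ∞ D.Θ (incl h p) :=
    (D.contMDiffOn_toFun _ hps).contMDiffAt (D.Θ.open_source.mem_nhds hps)
  have h4 : ContMDiffAt (𝓡 (k + 1)) 𝓘(ℝ, ℝ) ∞ ((F ∘ D.Θ.symm) ∘ D.Θ) (incl h p) :=
    h3.contMDiffAt.comp (incl h p) hΘ
  refine h4.congr_of_eventuallyEq ?_
  filter_upwards [D.Θ.open_source.mem_nhds hps] with z hz
  simp only [comp_apply, D.Θ.left_inv hz]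

/-- Conversely (and everywhere), `F ∘ incl` is smooth at `p` when `F` is smooth at `incl p`.
[cite: Milnor1963, Thm. 3.1] -/
theorem contMDiffAt_comp_incl {F : M → ℝ} (p : RegularSublevel h)
    (hF : ContMDiffAt (𝓡 (k + 1)) 𝓘(ℝ, ℝ) ∞ F (incl h p)) :
    ContMDiffAt (𝓡∂ (k + 1)) 𝓘(ℝ, ℝ) ∞ (F ∘ incl h) p :=
  hF.comp p (contMDiff_incl h p)

/-- **Smoothness off the level, `iff` form.** [cite: Milnor1963, Thm. 3.1] -/
theorem contMDiffAt_comp_incl_iff {F : M → ℝ} (p : RegularSublevel h) (hp : f (incl h p) < a) :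
    ContMDiffAt (𝓡∂ (k + 1)) 𝓘(ℝ, ℝ) ∞ (F ∘ incl h) p ↔
      ContMDiffAt (𝓡 (k + 1)) 𝓘(ℝ, ℝ) ∞ F (incl h p) :=
  ⟨contMDiffAt_of_comp_incl h p hp, contMDiffAt_comp_incl h p⟩

/-- **The Hessian of the restriction off the level is the ambient Hessian**: at a point with
`f p < a`, for a smooth ambient `F`, `Hess (F ∘ incl) p = Hess F (incl p)` (the half-slice chart
there is the extended chart of `M` translated by a constant vector, and second derivatives are
translation invariant). [cite: Milnor1963, Thm. 3.1 and §3] -/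
theorem mhessian_comp_incl_eq (F : M → ℝ) (p : RegularSublevel h) (hp : f (incl h p) < a) :
    mhessian (𝓡∂ (k + 1)) (F ∘ incl h) p = mhessian (𝓡 (k + 1)) F (incl h p) := by
  set Φ := halfSliceAtlas h with hΦ
  have hD : Φ.datum p = sublevelChartLT' k f a h.contMDiff.continuous p.1 :=
    halfSliceAtlas_datum_of_lt h p hp
  set G : EuclideanSpace ℝ (Fin (k + 1)) → ℝ := writtenInExtChartAt (𝓡 (k + 1)) 𝓘(ℝ, ℝ) p.1 F with hG
  set Fhat : EuclideanSpace ℝ (Fin (k + 1)) → ℝ := fun z => G (z + -shiftVec k p.1) with hFhat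
  have hps : p.1 ∈ (Φ.datum p).Θ.source := Φ.mem_source p
  have h0 : 0 < (Φ.datum p).Θ p.1 0 := by
    rw [hD] at hps ⊢
    exact sublevelChartLT'_apply_zero_pos hps
  have hF' : (F ∘ (Φ.datum p).Θ.symm) =ᶠ[𝓝 ((Φ.datum p).Θ p.1)] fun z => Fhat z + 0 := by
    refine Filter.Eventually.of_forall fun z => ?_
    rw [hD]
    simp [writtenInExtChartAt, hFhat, hG]
  have key := Φ.mhessian_comp_val_eq F p h0 hF'
  refine (show mhessian (𝓡∂ (k + 1)) (F ∘ incl h) p = _ from key).trans ?_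
  set z₀ : EuclideanSpace ℝ (Fin (k + 1)) := (Φ.datum p).Θ p.1 with hz₀def
  have hz₀v : z₀ + -shiftVec k p.1 = extChartAt (𝓡 (k + 1)) p.1 p.1 := by
    rw [hz₀def, hD, sublevelChartLT'_apply, add_neg_cancel_right]
  have hopen : IsOpen {z : EuclideanSpace ℝ (Fin (k + 1)) | 0 < z 0} :=
    isOpen_lt continuous_const (PiLp.continuous_apply 2 _ 0)
  have hHs : ∀ {z : EuclideanSpace ℝ (Fin (k + 1))}, 0 < z 0 → range (𝓡∂ (k + 1)) ∈ 𝓝 z := fun {z} hz => by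
    rw [range_modelWithCornersEuclideanHalfSpace]
    exact mem_interior_iff_mem_nhds.1 (by rw [interior_halfSpace]; exact hz)
  have h1 : fderivWithin ℝ Fhat (range (𝓡∂ (k + 1))) =ᶠ[𝓝 z₀] fderiv ℝ Fhat := by
    filter_upwards [hopen.mem_nhds h0] with z hz
    exact fderivWithin_of_mem_nhds (hHs hz)
  have h2 : fderivWithin ℝ (fderivWithin ℝ Fhat (range (𝓡∂ (k + 1)))) (range (𝓡∂ (k + 1))) z₀ =
      fderiv ℝ (fderiv ℝ Fhat) z₀ := by
    rw [h1.fderivWithin_eq_of_nhds, fderivWithin_of_mem_nhds (hHs h0)]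
  have h3 : fderiv ℝ Fhat = fun z => fderiv ℝ G (z + -shiftVec k p.1) := by
    funext z
    exact fderiv_comp_add_right (-shiftVec k p.1)
  have h4 : fderiv ℝ (fderiv ℝ Fhat) z₀ = fderiv ℝ (fderiv ℝ G) (z₀ + -shiftVec k p.1) := by
    rw [h3]
    exact fderiv_comp_add_right (f := fderiv ℝ G) (-shiftVec k p.1)
  unfold mhessian
  rw [h2, h4, hz₀v, hG]
  simp only [ModelWithCorners.Boundaryless.range_eq_univ, fderivWithin_univ]
  rfl

/-- **The Morse index of the restriction off the level is the ambient one.**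
[cite: Milnor1963, Thm. 3.1 and §3] -/
theorem morseIndex_comp_incl_eq (F : M → ℝ) (p : RegularSublevel h) (hp : f (incl h p) < a) :
    morseIndex (𝓡∂ (k + 1)) (F ∘ incl h) p = morseIndex (𝓡 (k + 1)) F (incl h p) := by
  rw [morseIndex, mhessian_comp_incl_eq h F p hp, morseIndex]

/-- **Nondegeneracy of the Hessian off the level transfers.** [cite: Milnor1963, Thm. 3.1 and §3] -/
theorem nondegenerate_mhessian_comp_incl_iff (F : M → ℝ) (p : RegularSublevel h)
    (hp : f (incl h p) < a) :
    (mhessian (𝓡∂ (k + 1)) (F ∘ incl h) p).Nondegenerate ↔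
      (mhessian (𝓡 (k + 1)) F (incl h p)).Nondegenerate := by
  rw [mhessian_comp_incl_eq h F p hp]

end RegularSublevel

end Literature.Topology.FourManifolds
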